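import Mathlib
import HarnessLib
import Summits.NavierStokesRegularity.NavierStokesRegularity.Theorems.WakeRatchetMinimalViscousBlowupEveryShellFires

/-!
# Route `WakeRatchet`, crux `MinimalViscousBlowup` (stmt-NavierStokesRegularity-22743) — LINE g12-2 (ns-idea-1 g12, HEART-RG §10):
# THE RESIDUE OF THE FRONT CLOCK after `noSustainedStall` + `noGlobalLull` — covering step `(H1) ∧ (H2) ⇒ (FC′)` and `(FC′) ⇒ (H1)`

ns-idea-1 g12's kernel-checked file `lines/g12-2/FrontClockResidue.lean` v3 (sha16 a44187a3e51d3e09; evidence on ⟨22743⟩), landed VERBATIM by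
the hand ns-qj-p1 g7 (`clock_of_litMeasure_retreatDepth`, `frontClock_of_litMeasure_retreatDepth`, `litMeasure_of_frontClock`, `clock_of_cover`,
`frontClock_of_litMeasure_retreatDepth₂`).  `--supports stmt-NavierStokesRegularity-22743 --as helper`; no NS regularity statement is proved.


MODEL lattice only.  With "lit" = level `λᵏ‖X_k‖² ≥ b` (any fixed `0 < b ≤ b₀ν²`, `b₀ = 1/(32768λ¹⁶)` the firing level of (FC′)):
`noSustainedStall` bounds ONE lit episode of shell `k` by `D/(νλ^{2k})` and `noGlobalLull` says SOME shell is lit at every instant.  What (FC′)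
(`stub_firedFrontClockAtThreshold` of LINE g11-1 v3.9) still needs is exactly the pair
* **lit measure** `(H1)`: the TOTAL lit time of shell `k` is `≤ A·λ^{−2k}` (one episode ⇐ `noSustainedStall`; the count of re-lightings is the content);
* **retreat depth** `(H2)`: once shell `m` was lit, at every later time some shell `≥ m − d` is lit (`noGlobalLull` gives SOME lit shell; the depth is the content);
and this file PROVES the covering step `(H1) ∧ (H2) ⇒ (FC′)` with `K = A·λ^{2d}/(1 − λ^{−2})` (`frontClock_of_litMeasure_retreatDepth`): `[t,T) ⊆ ⋃_{n ≥ m−d} lit_n`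
and Lebesgue subadditivity, and the easy half of the converse, `(FC′) ⇒ (H1)` with `A = K` (`litMeasure_of_frontClock`); `(FC′) ⇒ (H2)` is expected via
re-ignition + minimal rise time (HEART-RG §10(e)), so (H1) ∧ (H2) is a DECOMPOSITION of (FC′) into two individually weaker conjuncts, not a strengthening.
No claim that (H1)/(H2) hold; they are the heart in clock language (instrument rows E-g12-1 «parking depth», E-g12-2 «leaky circuit»).
[cite: Tao2016AveragedNS, §5; BarbatoMorandinRomito2011, §3.1]
-/

noncomputable section

set_option linter.dupNamespace false

open Set Filter Topology MeasureTheory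
open Literature.Analysis.FluidPDE Literature.Analysis.FluidPDE.TaoCascade

namespace Summit.NavierStokesRegularity.NavierStokesRegularity.Theorems.MinimalViscousBlowup.ThresholdRay

/-- **Covering step of the front clock.**  `ℓ : ℕ → ℝ → ℝ` any family of "levels" on `[0,T)`, lit threshold `b`, ratio `0 < q < 1`:
if the lit set of index `n` inside `[0,T)` has Lebesgue measure `≤ A qⁿ` (H1) and, once index `m` was lit at `s₀`, at every later `s < T` some index
`n` with `m ≤ n + d` is lit (H2), then `T − t ≤ A q^{m−d}/(1−q)` whenever index `m` was lit at some `s₀ ≤ t < T` (`m − d` truncated). [folklore] -/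
theorem clock_of_litMeasure_retreatDepth {T b A q : ℝ} {d : ℕ} (ℓ : ℕ → ℝ → ℝ) (hA : 0 ≤ A) (hq0 : 0 ≤ q) (hq1 : q < 1)
    (H1 : ∀ n : ℕ, volume {s : ℝ | 0 ≤ s ∧ s < T ∧ b ≤ ℓ n s} ≤ ENNReal.ofReal (A * q ^ n))
    (H2 : ∀ (m : ℕ) (s₀ s : ℝ), 0 ≤ s₀ → s₀ ≤ s → s < T → b ≤ ℓ m s₀ → ∃ n : ℕ, m ≤ n + d ∧ b ≤ ℓ n s) :
    ∀ (m : ℕ) (t : ℝ), 0 ≤ t → t < T → (∃ s₀, 0 ≤ s₀ ∧ s₀ ≤ t ∧ b ≤ ℓ m s₀) →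
      T - t ≤ A * q ^ (m - d) / (1 - q) := by
  intro m t ht0 htT ⟨s₀, hs₀0, hs₀t, hlit⟩
  set N : ℕ := m - d with hN
  -- `[t,T) ⊆ ⋃_k lit_{N+k}`
  have hcover : Ico t T ⊆ ⋃ k : ℕ, {s : ℝ | 0 ≤ s ∧ s < T ∧ b ≤ ℓ (N + k) s} := by
    intro s hs
    obtain ⟨n, hmn, hn⟩ := H2 m s₀ s hs₀0 (hs₀t.trans hs.1) hs.2 hlit
    have hNn : N ≤ n := by rw [hN]; omega
    refine mem_iUnion.2 ⟨n - N, ?_⟩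
    have : N + (n - N) = n := by omega
    rw [this]
    exact ⟨ht0.trans hs.1, hs.2, hn⟩
  -- summing the measures
  have hsum : Summable fun k : ℕ => A * q ^ (N + k) := by
    have : (fun k : ℕ => A * q ^ (N + k)) = fun k : ℕ => A * q ^ N * q ^ k := by
      funext k; rw [pow_add]; ring
    rw [this]
    exact (summable_geometric_of_lt_one hq0 hq1).mul_left _
  have htsum : ∑' k : ℕ, A * q ^ (N + k) = A * q ^ N / (1 - q) := by
    have : (fun k : ℕ => A * q ^ (N + k)) = fun k : ℕ => A * q ^ N * q ^ k := by
      funext k; rw [pow_add]; ring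
    rw [this, tsum_mul_left, tsum_geometric_of_lt_one hq0 hq1, div_eq_mul_inv]
  have hvol : volume (Ico t T) ≤ ENNReal.ofReal (A * q ^ N / (1 - q)) := by
    calc volume (Ico t T) ≤ volume (⋃ k : ℕ, {s : ℝ | 0 ≤ s ∧ s < T ∧ b ≤ ℓ (N + k) s}) := measure_mono hcover
      _ ≤ ∑' k : ℕ, volume {s : ℝ | 0 ≤ s ∧ s < T ∧ b ≤ ℓ (N + k) s} := measure_iUnion_le _
      _ ≤ ∑' k : ℕ, ENNReal.ofReal (A * q ^ (N + k)) := ENNReal.tsum_le_tsum fun k => H1 (N + k)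
      _ = ENNReal.ofReal (∑' k : ℕ, A * q ^ (N + k)) :=
          (ENNReal.ofReal_tsum_of_nonneg (fun k => by positivity) hsum).symm
      _ = ENNReal.ofReal (A * q ^ N / (1 - q)) := by rw [htsum]
  rw [Real.volume_Ico] at hvol
  have hnn : 0 ≤ A * q ^ N / (1 - q) := div_nonneg (by positivity) (by linarith)
  exact (ENNReal.ofReal_le_ofReal_iff hnn).1 hvol

/-- **(FC′) from lit measure + retreat depth** — the residue of the fired front clock after `noSustainedStall`/`noGlobalLull`, in the exact currency of
`stub_firedFrontClockAtThreshold` (LINE g11-1 v3.9): for a trajectory `X` with lit threshold `b ≤ ν²/(32768λ¹⁶)` (so a FIRED shell is lit),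
(H1) `|{s ∈ [0,T) : λᵏ‖X_k(s)‖² ≥ b}| ≤ A λ^{−2k}` for every `k` and (H2) "once shell `m` is lit, at every later time some shell `≥ m−d` is lit" give
`T − t ≤ K λ^{−2m}` after shell `m` fired by time `t`, with `K = Aλ^{2d}/(1−λ^{−2})`.  MODEL lattice only; (H1), (H2) are NOT claimed. [folklore] -/
theorem frontClock_of_litMeasure_retreatDepth {ε₀ ν T b A : ℝ} {d : ℕ} (hε : 0 < ε₀) (hA : 0 ≤ A)
    {X : Fin 4 → ℤ → ℝ → ℝ}
    (hb : b ≤ 1 / (32768 * (1 + ε₀) ^ 16) * ν ^ 2)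
    (H1 : ∀ k : ℕ, volume {s : ℝ | 0 ≤ s ∧ s < T ∧ b ≤ (1 + ε₀) ^ k * ‖shellVec X k s‖ ^ 2} ≤
      ENNReal.ofReal (A * ((1 + ε₀) ^ 2)⁻¹ ^ k))
    (H2 : ∀ (m : ℕ) (s₀ s : ℝ), 0 ≤ s₀ → s₀ ≤ s → s < T → b ≤ (1 + ε₀) ^ m * ‖shellVec X m s₀‖ ^ 2 →
      ∃ n : ℕ, m ≤ n + d ∧ b ≤ (1 + ε₀) ^ n * ‖shellVec X n s‖ ^ 2) :
    ∃ K : ℝ, ∀ (m : ℕ) (t : ℝ), 0 ≤ t → t < T →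
      (∃ s, 0 ≤ s ∧ s ≤ t ∧ 1 / (32768 * (1 + ε₀) ^ 16) * ν ^ 2 ≤ (1 + ε₀) ^ m * ‖shellVec X m s‖ ^ 2) →
      T - t ≤ K / (1 + ε₀) ^ (2 * m) := by
  have hl0 : (0 : ℝ) < 1 + ε₀ := by linarith
  have hl1 : (1 : ℝ) < 1 + ε₀ := by linarith
  set q : ℝ := ((1 + ε₀) ^ 2)⁻¹ with hq
  have hq0 : 0 < q := by rw [hq]; positivity
  have hq1 : q < 1 := by rw [hq]; exact inv_lt_one_of_one_lt₀ (by nlinarith)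
  have hqpow : ∀ k : ℕ, q ^ k * (1 + ε₀) ^ (2 * k) = 1 := fun k => by
    rw [hq, inv_pow, ← pow_mul, inv_mul_cancel₀ (pow_ne_zero _ hl0.ne')]
  clear_value q
  have hclock := clock_of_litMeasure_retreatDepth (T := T) (b := b) (d := d)
    (fun (n : ℕ) (s : ℝ) => (1 + ε₀) ^ n * ‖shellVec X n s‖ ^ 2) hA hq0.le hq1 H1 H2
  refine ⟨A * (1 + ε₀) ^ (2 * d) / (1 - q), fun m t ht0 htT hfired => ?_⟩
  obtain ⟨s, hs0, hst, hs⟩ := hfired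
  have h := hclock m t ht0 htT ⟨s, hs0, hst, hb.trans hs⟩
  -- `q^{m-d} ≤ λ^{2d} / λ^{2m}`
  have hP : 0 < (1 + ε₀) ^ (2 * m) := pow_pos hl0 _
  have hqm : q ^ (m - d) ≤ (1 + ε₀) ^ (2 * d) / (1 + ε₀) ^ (2 * m) := by
    rw [le_div_iff₀ hP]
    rcases le_or_gt d m with hdm | hdm
    · -- `q^{m-d} λ^{2m} = λ^{2d}`
      have : q ^ (m - d) * (1 + ε₀) ^ (2 * m) = (1 + ε₀) ^ (2 * d) * (q ^ (m - d) * (1 + ε₀) ^ (2 * (m - d))) := by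
        have hsplit : (1 + ε₀) ^ (2 * m) = (1 + ε₀) ^ (2 * d) * (1 + ε₀) ^ (2 * (m - d)) := by
          rw [← pow_add]; congr 1; omega
        rw [hsplit]; ring
      rw [this, hqpow, mul_one]
    · have hmd : m - d = 0 := by omega
      rw [hmd, pow_zero, one_mul]
      exact pow_le_pow_right₀ hl1.le (by omega)
  have h1q : 0 < 1 - q := by linarith
  calc T - t ≤ A * q ^ (m - d) / (1 - q) := h
    _ ≤ A * ((1 + ε₀) ^ (2 * d) / (1 + ε₀) ^ (2 * m)) / (1 - q) :=
        div_le_div_of_nonneg_right (mul_le_mul_of_nonneg_left hqm hA) h1q.le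
    _ = A * (1 + ε₀) ^ (2 * d) / (1 - q) / (1 + ε₀) ^ (2 * m) := by
        field_simp

/-- **Converse, first half: (FC′) ⇒ (H1)** with `A = K` at the firing level `b₀ν²`, `b₀ = 1/(32768λ¹⁶)`: under the fired front clock every
lit instant `s` of shell `k` (level `≥ b₀ν²` at `s`, so shell `k` has fired by time `s`) satisfies `T − s ≤ K/λ^{2k}`, i.e. the lit set of shell `k`
lies in `[T − Kλ^{−2k}, T]` and has measure `≤ K·(λ^{−2})^k`.  (The second half, (FC′) ⇒ bounded retreat depth (H2), needs the re-ignition of a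
dark upper block before blow-up and a minimal rise time `≳ λ^{−2k}` per re-lighting — HEART-RG §10(e); not typed here.)  MODEL lattice only. [folklore] -/
theorem litMeasure_of_frontClock {ε₀ ν T K : ℝ} (hε : 0 < ε₀) {X : Fin 4 → ℤ → ℝ → ℝ}
    (hFC : ∀ (m : ℕ) (t : ℝ), 0 ≤ t → t < T →
      (∃ s, 0 ≤ s ∧ s ≤ t ∧ 1 / (32768 * (1 + ε₀) ^ 16) * ν ^ 2 ≤ (1 + ε₀) ^ m * ‖shellVec X m s‖ ^ 2) →
      T - t ≤ K / (1 + ε₀) ^ (2 * m)) :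
    ∀ k : ℕ, volume {s : ℝ | 0 ≤ s ∧ s < T ∧
        1 / (32768 * (1 + ε₀) ^ 16) * ν ^ 2 ≤ (1 + ε₀) ^ k * ‖shellVec X k s‖ ^ 2} ≤
      ENNReal.ofReal (K * ((1 + ε₀) ^ 2)⁻¹ ^ k) := by
  intro k
  have hl0 : (0 : ℝ) < 1 + ε₀ := by linarith
  have hsub : {s : ℝ | 0 ≤ s ∧ s < T ∧
      1 / (32768 * (1 + ε₀) ^ 16) * ν ^ 2 ≤ (1 + ε₀) ^ k * ‖shellVec X k s‖ ^ 2} ⊆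
      Icc (T - K / (1 + ε₀) ^ (2 * k)) T := by
    intro s hs
    have h := hFC k s hs.1 hs.2.1 ⟨s, hs.1, le_rfl, hs.2.2⟩
    exact ⟨by linarith, hs.2.1.le⟩
  calc volume {s : ℝ | 0 ≤ s ∧ s < T ∧
        1 / (32768 * (1 + ε₀) ^ 16) * ν ^ 2 ≤ (1 + ε₀) ^ k * ‖shellVec X k s‖ ^ 2}
      ≤ volume (Icc (T - K / (1 + ε₀) ^ (2 * k)) T) := measure_mono hsub
    _ = ENNReal.ofReal (K / (1 + ε₀) ^ (2 * k)) := by rw [Real.volume_Icc]; congr 1; ring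
    _ = ENNReal.ofReal (K * ((1 + ε₀) ^ 2)⁻¹ ^ k) := by
        congr 1; rw [inv_pow, ← pow_mul, div_eq_mul_inv]

/-! ### Two-threshold form (v3): fired premise, dark-level lit sets — the exact currency of `retreatDepth_of_frontClock` -/

/-- **Covering step, abstract form.**  `Fired m s`, `Lit n s` any predicates, ratio `0 ≤ q < 1`: if the `Lit n`-set inside `[0,T)` has measure
`≤ A qⁿ` (H1) and, once `m` was fired at `s₀`, at every later `s < T` some `n` with `m ≤ n + d` is lit (H2), then `T − t ≤ A q^{m−d}/(1−q)` whenever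
`m` was fired at some `s₀ ≤ t < T`. [folklore] -/
theorem clock_of_cover {T A q : ℝ} {d : ℕ} (Fired Lit : ℕ → ℝ → Prop) (hA : 0 ≤ A) (hq0 : 0 ≤ q) (hq1 : q < 1)
    (H1 : ∀ n : ℕ, volume {s : ℝ | 0 ≤ s ∧ s < T ∧ Lit n s} ≤ ENNReal.ofReal (A * q ^ n))
    (H2 : ∀ (m : ℕ) (s₀ s : ℝ), 0 ≤ s₀ → s₀ ≤ s → s < T → Fired m s₀ → ∃ n : ℕ, m ≤ n + d ∧ Lit n s) :
    ∀ (m : ℕ) (t : ℝ), 0 ≤ t → t < T → (∃ s₀, 0 ≤ s₀ ∧ s₀ ≤ t ∧ Fired m s₀) →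
      T - t ≤ A * q ^ (m - d) / (1 - q) := by
  intro m t ht0 htT ⟨s₀, hs₀0, hs₀t, hfired⟩
  set N : ℕ := m - d with hN
  have hcover : Ico t T ⊆ ⋃ k : ℕ, {s : ℝ | 0 ≤ s ∧ s < T ∧ Lit (N + k) s} := by
    intro s hs
    obtain ⟨n, hmn, hn⟩ := H2 m s₀ s hs₀0 (hs₀t.trans hs.1) hs.2 hfired
    have hNn : N ≤ n := by rw [hN]; omega
    refine mem_iUnion.2 ⟨n - N, ?_⟩
    have : N + (n - N) = n := by omega
    rw [this]
    exact ⟨ht0.trans hs.1, hs.2, hn⟩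
  have hfun : (fun k : ℕ => A * q ^ (N + k)) = fun k : ℕ => A * q ^ N * q ^ k := by
    funext k; rw [pow_add]; ring
  have hsum : Summable fun k : ℕ => A * q ^ (N + k) := by
    rw [hfun]; exact (summable_geometric_of_lt_one hq0 hq1).mul_left _
  have htsum : ∑' k : ℕ, A * q ^ (N + k) = A * q ^ N / (1 - q) := by
    rw [hfun, tsum_mul_left, tsum_geometric_of_lt_one hq0 hq1, div_eq_mul_inv]
  have hvol : volume (Ico t T) ≤ ENNReal.ofReal (A * q ^ N / (1 - q)) := by
    calc volume (Ico t T) ≤ volume (⋃ k : ℕ, {s : ℝ | 0 ≤ s ∧ s < T ∧ Lit (N + k) s}) := measure_mono hcover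
      _ ≤ ∑' k : ℕ, volume {s : ℝ | 0 ≤ s ∧ s < T ∧ Lit (N + k) s} := measure_iUnion_le _
      _ ≤ ∑' k : ℕ, ENNReal.ofReal (A * q ^ (N + k)) := ENNReal.tsum_le_tsum fun k => H1 (N + k)
      _ = ENNReal.ofReal (∑' k : ℕ, A * q ^ (N + k)) :=
          (ENNReal.ofReal_tsum_of_nonneg (fun k => by positivity) hsum).symm
      _ = ENNReal.ofReal (A * q ^ N / (1 - q)) := by rw [htsum]
  rw [Real.volume_Ico] at hvol
  have hnn : 0 ≤ A * q ^ N / (1 - q) := div_nonneg (by positivity) (by linarith)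
  exact (ENNReal.ofReal_le_ofReal_iff hnn).1 hvol

/-- **(H1″) ∧ (H2″) ⇒ (FC′)** — two-threshold form matching `retreatDepth_of_frontClock` (Reignition file) EXACTLY: FIRING level
`b₀ν² = ν²/(32768λ¹⁶)` in the premises, DARKNESS level `b′ = ν²/(32768λ¹⁹)` for "lit".  (H1″) `|{s ∈ [0,T) : λᵏ‖X_k(s)‖² > b′}| ≤ Aλ^{−2k}`;
(H2″) after shell `m` FIRED, at every later time some shell `n ≥ m − d` is above `b′`.  Then `T − t ≤ Kλ^{−2m}` once shell `m` fired by `t`,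
`K = Aλ^{2d}/(1−λ^{−2})`.  With `retreatDepth_of_frontClock` ((FC′) ⇒ (H2″)) and `litMeasure_of_frontClock` ((FC′) ⇒ (H1) at the firing level)
this pins the residue of `stub_firedFrontClockAtThreshold` on (H1″) (lit measure at the darkness level, one power of `λ` beyond the energy
budget).  MODEL lattice only; (H1″), (H2″) are NOT claimed. [folklore] -/
theorem frontClock_of_litMeasure_retreatDepth₂ {ε₀ ν T A : ℝ} {d : ℕ} (hε : 0 < ε₀) (hA : 0 ≤ A)
    {X : Fin 4 → ℤ → ℝ → ℝ}
    (H1 : ∀ k : ℕ, volume {s : ℝ | 0 ≤ s ∧ s < T ∧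
        1 / (32768 * (1 + ε₀) ^ 19) * ν ^ 2 < (1 + ε₀) ^ k * ‖shellVec X k s‖ ^ 2} ≤
      ENNReal.ofReal (A * ((1 + ε₀) ^ 2)⁻¹ ^ k))
    (H2 : ∀ (m : ℕ) (s₀ s : ℝ), 0 ≤ s₀ → s₀ ≤ s → s < T →
      1 / (32768 * (1 + ε₀) ^ 16) * ν ^ 2 ≤ (1 + ε₀) ^ m * ‖shellVec X m s₀‖ ^ 2 →
      ∃ n : ℕ, m ≤ n + d ∧ 1 / (32768 * (1 + ε₀) ^ 19) * ν ^ 2 < (1 + ε₀) ^ n * ‖shellVec X n s‖ ^ 2) :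
    ∃ K : ℝ, ∀ (m : ℕ) (t : ℝ), 0 ≤ t → t < T →
      (∃ s, 0 ≤ s ∧ s ≤ t ∧ 1 / (32768 * (1 + ε₀) ^ 16) * ν ^ 2 ≤ (1 + ε₀) ^ m * ‖shellVec X m s‖ ^ 2) →
      T - t ≤ K / (1 + ε₀) ^ (2 * m) := by
  have hl0 : (0 : ℝ) < 1 + ε₀ := by linarith
  have hl1 : (1 : ℝ) < 1 + ε₀ := by linarith
  set q : ℝ := ((1 + ε₀) ^ 2)⁻¹ with hq
  have hq0 : 0 < q := by rw [hq]; positivity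
  have hq1 : q < 1 := by rw [hq]; exact inv_lt_one_of_one_lt₀ (by nlinarith)
  have hqpow : ∀ k : ℕ, q ^ k * (1 + ε₀) ^ (2 * k) = 1 := fun k => by
    rw [hq, inv_pow, ← pow_mul, inv_mul_cancel₀ (pow_ne_zero _ hl0.ne')]
  clear_value q
  have hclock := clock_of_cover (T := T) (d := d)
    (fun (m : ℕ) (s : ℝ) => 1 / (32768 * (1 + ε₀) ^ 16) * ν ^ 2 ≤ (1 + ε₀) ^ m * ‖shellVec X m s‖ ^ 2)
    (fun (n : ℕ) (s : ℝ) => 1 / (32768 * (1 + ε₀) ^ 19) * ν ^ 2 < (1 + ε₀) ^ n * ‖shellVec X n s‖ ^ 2)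
    hA hq0.le hq1 H1 H2
  refine ⟨A * (1 + ε₀) ^ (2 * d) / (1 - q), fun m t ht0 htT hfired => ?_⟩
  have h := hclock m t ht0 htT hfired
  have hP : 0 < (1 + ε₀) ^ (2 * m) := pow_pos hl0 _
  have hqm : q ^ (m - d) ≤ (1 + ε₀) ^ (2 * d) / (1 + ε₀) ^ (2 * m) := by
    rw [le_div_iff₀ hP]
    rcases le_or_gt d m with hdm | hdm
    · have : q ^ (m - d) * (1 + ε₀) ^ (2 * m) = (1 + ε₀) ^ (2 * d) * (q ^ (m - d) * (1 + ε₀) ^ (2 * (m - d))) := by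
        have hsplit : (1 + ε₀) ^ (2 * m) = (1 + ε₀) ^ (2 * d) * (1 + ε₀) ^ (2 * (m - d)) := by
          rw [← pow_add]; congr 1; omega
        rw [hsplit]; ring
      rw [this, hqpow, mul_one]
    · have hmd : m - d = 0 := by omega
      rw [hmd, pow_zero, one_mul]
      exact pow_le_pow_right₀ hl1.le (by omega)
  have h1q : 0 < 1 - q := by linarith
  calc T - t ≤ A * q ^ (m - d) / (1 - q) := h
    _ ≤ A * ((1 + ε₀) ^ (2 * d) / (1 + ε₀) ^ (2 * m)) / (1 - q) :=
        div_le_div_of_nonneg_right (mul_le_mul_of_nonneg_left hqm hA) h1q.le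
    _ = A * (1 + ε₀) ^ (2 * d) / (1 - q) / (1 + ε₀) ^ (2 * m) := by
        field_simp

end Summit.NavierStokesRegularity.NavierStokesRegularity.Theorems.MinimalViscousBlowup.ThresholdRay

end
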